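import Mathlib
import Summits.Ventures.PercRepro2.HCov
import Summits.Ventures.PercRepro2.HCovSwap
import Summits.Ventures.PercRepro2.RECMReduction
import Summits.Ventures.PercRepro2.CCWReduced
import Summits.Ventures.PercRepro2.CutVertexPaths
import Summits.Ventures.PercRepro2.CutOneFar
import Summits.Ventures.PercRepro2.CutPrune
import Summits.Ventures.PercRepro2.CutTwoFarA13Classes
import Summits.Ventures.PercRepro2.GcSkelRules
import Summits.Ventures.PercRepro2.GcSkelReduction
import Summits.Ventures.PercRepro2.GcSkelReductionS

/-!
# The cut-vertex-reduced class: (HCOV) lives on the cores (blind cell PercRepro2, typer-1 g52)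

The cut-vertex reductions of this lineage, in one weighted statement with `GcSkelReductionS.lean`:

* a MARK-FREE side of a cut vertex is invisible — `CutPrune.Gc_eq_right` (typer-1 g48);
* ONE far mark behind a cut vertex `v` is a pendant mark at `v` of weight `P(w ↔ v by the far
  edges)` — `CutOneFar.Gc_eq_reduced` (typer-1 g48, S3 §12.2 / (G5));
* TWO marks on one side of a cut vertex (or at it) and three on the other is a THEOREM —
  `CutTwoFar.HCov_cut_twoLeft` (typer-1 g50 / g51, the ten classes of S3.5 (C5)).

**`WReducedC`** := `WReducedS` (simple; unmarked non-loop degrees `0` or `≥ 3`; `o`, `b` not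
leaves; pendant marks at unmarked vertices) ∧ for every cut-vertex decomposition
`CutVertex ends side L v Rt`: a mark-free left side carries no non-loop edge (`prune`), a left
side with a single far mark carries at most one non-loop edge (`oneFar`), and no `2 + 3` split of
the marks (`twoThree`). By `CutVertex.symm` the clauses cover both sides.

**`HCov_all_iff_HCovWRedC_all`**: (HCOV) for every finite weighted graph with five distinct marks
⟺ (HCOV) on `WReducedC` — strong induction on `nonLoopCard` ACROSS edge types (the prune and
one-far reductions move to the right-edge subtypes `CutPrune.RightEdge` / `CutOneFar.REdge`;
`nonLoopCard_lt_of_inj` counts). What survives: the only separations of a core are a root or `a₃`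
pendant at an unmarked vertex of degree `≥ 3` — S3.10's (G1) / (G4-u) — nothing of them is closed
here.
-/

namespace Summit.Ventures.PercRepro2

open CovForm Contract RECM CutVertexM9

namespace WRed

/-! ## Counting non-loop edges across edge types -/

section Count

variable {V : Type*} {E : Type*} [Fintype E] [DecidableEq E] [DecidableEq V]

/-- The number of non-loop edges of side `true`. -/
def leftCard (ends : E → Sym2 V) (side : E → Bool) : ℕ :=
  (Finset.univ.filter fun g => side g = true ∧ ¬ (ends g).IsDiag).card

/-- **Fewer non-loop edges through an injection that misses one**: if `f` sends the non-loop edges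
of `ends'` injectively to non-loop edges of `ends` and misses the non-loop edge `g`, then `ends'`
has fewer non-loop edges. -/
lemma nonLoopCard_lt_of_inj {E' : Type*} [Fintype E'] [DecidableEq E'] {ends : E → Sym2 V}
    {ends' : E' → Sym2 V} (f : E' → E) (hf : ∀ e, ¬ (ends' e).IsDiag → ¬ (ends (f e)).IsDiag)
    (hinj : ∀ e₁ e₂, ¬ (ends' e₁).IsDiag → ¬ (ends' e₂).IsDiag → f e₁ = f e₂ → e₁ = e₂)
    {g : E} (hg : ¬ (ends g).IsDiag) (hmiss : ∀ e, ¬ (ends' e).IsDiag → f e ≠ g) :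
    nonLoopCard ends' < nonLoopCard ends := by
  unfold nonLoopCard
  set S' := Finset.univ.filter fun e : E' => ¬ (ends' e).IsDiag with hS'
  have hinjOn : Set.InjOn f ↑S' := by
    intro e₁ h₁ e₂ h₂ h
    rw [Finset.mem_coe, hS', Finset.mem_filter] at h₁ h₂
    exact hinj e₁ e₂ h₁.2 h₂.2 h
  rw [← Finset.card_image_of_injOn hinjOn]
  apply Finset.card_lt_card
  rw [Finset.ssubset_iff_of_subset]
  · refine ⟨g, ?_, ?_⟩
    · simp only [Finset.mem_filter, Finset.mem_univ, true_and]
      exact hg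
    · intro hgm
      rw [Finset.mem_image] at hgm
      obtain ⟨e, he, hfe⟩ := hgm
      rw [hS', Finset.mem_filter] at he
      exact hmiss e he.2 hfe
  · intro x hx
    rw [Finset.mem_image] at hx
    obtain ⟨e, he, rfl⟩ := hx
    rw [hS', Finset.mem_filter] at he
    simp only [Finset.mem_filter, Finset.mem_univ, true_and]
    exact hf e he.2

/-- Pruning a side that carries a non-loop edge lowers the number of non-loop edges. -/
lemma nonLoopCard_prune_lt {ends : E → Sym2 V} {side : E → Bool} {g : E} (hg : side g = true)
    (hgd : ¬ (ends g).IsDiag) :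
    nonLoopCard (CutPrune.rends ends side) < nonLoopCard ends :=
  nonLoopCard_lt_of_inj (fun e => e.1) (fun _ he => he) (fun _ _ _ _ h => Subtype.ext h) hgd
    (fun e _ he => by
      have h2 := e.2
      rw [he, hg] at h2
      exact Bool.noConfusion h2)

/-- Replacing a far side with at least two non-loop edges by one pendant edge lowers the number of
non-loop edges. -/
lemma nonLoopCard_oneFar_lt {ends : E → Sym2 V} {side : E → Bool} (v w : V) {g₁ g₂ : E}
    (hne : g₁ ≠ g₂) (hg₁ : side g₁ = true) (hg₁d : ¬ (ends g₁).IsDiag) (hg₂ : side g₂ = true)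
    (hg₂d : ¬ (ends g₂).IsDiag) :
    nonLoopCard (CutOneFar.rends ends side v w) < nonLoopCard ends := by
  refine nonLoopCard_lt_of_inj (Sum.elim (fun e => e.1) (fun _ => g₁)) ?_ ?_ hg₂d ?_
  · intro e he
    cases e with
    | inl e => exact he
    | inr _ => exact hg₁d
  · intro e₁ e₂ _ _ h
    cases e₁ with
    | inl e₁ =>
      cases e₂ with
      | inl e₂ => exact congrArg Sum.inl (Subtype.ext h)
      | inr _ =>
        have h2 := e₁.2
        rw [Sum.elim_inl, Sum.elim_inr] at h
        rw [h, hg₁] at h2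
        exact Bool.noConfusion h2
    | inr u =>
      cases e₂ with
      | inl e₂ =>
        have h2 := e₂.2
        rw [Sum.elim_inl, Sum.elim_inr] at h
        rw [← h, hg₁] at h2
        exact Bool.noConfusion h2
      | inr u' => cases u; cases u'; rfl
  · intro e _ he
    cases e with
    | inl e =>
      have h2 := e.2
      rw [Sum.elim_inl] at he
      rw [he, hg₂] at h2
      exact Bool.noConfusion h2
    | inr _ =>
      rw [Sum.elim_inr] at he
      exact hne he

end Count

/-! ## The cut-vertex-reduced class -/

section ClassC

variable {V : Type*} {E : Type*} [Fintype E] [DecidableEq E] [DecidableEq V]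

/-- **The ten `2 + 3` splits** of `CutTwoFar.HCov_cut_twoLeft`: two of the five marks on the left
of the cut vertex `v` (or at `v`), the other three on its right (or at `v`). -/
def TwoThree (L : Set V) (v : V) (Rt : Set V) (o a₁ a₂ a₃ b : V) : Prop :=
  ((a₁ ∈ L ∨ a₁ = v) ∧ (a₂ ∈ L ∨ a₂ = v) ∧ (o ∈ Rt ∨ o = v) ∧ (a₃ ∈ Rt ∨ a₃ = v) ∧ (b ∈ Rt ∨ b = v)) ∨
  ((a₁ ∈ L ∨ a₁ = v) ∧ (a₃ ∈ L ∨ a₃ = v) ∧ (o ∈ Rt ∨ o = v) ∧ (a₂ ∈ Rt ∨ a₂ = v) ∧ (b ∈ Rt ∨ b = v)) ∨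
  ((a₂ ∈ L ∨ a₂ = v) ∧ (a₃ ∈ L ∨ a₃ = v) ∧ (o ∈ Rt ∨ o = v) ∧ (a₁ ∈ Rt ∨ a₁ = v) ∧ (b ∈ Rt ∨ b = v)) ∨
  ((a₁ ∈ L ∨ a₁ = v) ∧ (o ∈ L ∨ o = v) ∧ (a₂ ∈ Rt ∨ a₂ = v) ∧ (a₃ ∈ Rt ∨ a₃ = v) ∧ (b ∈ Rt ∨ b = v)) ∨
  ((a₂ ∈ L ∨ a₂ = v) ∧ (o ∈ L ∨ o = v) ∧ (a₁ ∈ Rt ∨ a₁ = v) ∧ (a₃ ∈ Rt ∨ a₃ = v) ∧ (b ∈ Rt ∨ b = v)) ∨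
  ((a₁ ∈ L ∨ a₁ = v) ∧ (b ∈ L ∨ b = v) ∧ (a₂ ∈ Rt ∨ a₂ = v) ∧ (a₃ ∈ Rt ∨ a₃ = v) ∧ (o ∈ Rt ∨ o = v)) ∨
  ((a₂ ∈ L ∨ a₂ = v) ∧ (b ∈ L ∨ b = v) ∧ (a₁ ∈ Rt ∨ a₁ = v) ∧ (a₃ ∈ Rt ∨ a₃ = v) ∧ (o ∈ Rt ∨ o = v)) ∨
  ((o ∈ L ∨ o = v) ∧ (a₃ ∈ L ∨ a₃ = v) ∧ (a₁ ∈ Rt ∨ a₁ = v) ∧ (a₂ ∈ Rt ∨ a₂ = v) ∧ (b ∈ Rt ∨ b = v)) ∨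
  ((a₃ ∈ L ∨ a₃ = v) ∧ (b ∈ L ∨ b = v) ∧ (a₁ ∈ Rt ∨ a₁ = v) ∧ (a₂ ∈ Rt ∨ a₂ = v) ∧ (o ∈ Rt ∨ o = v)) ∨
  ((o ∈ L ∨ o = v) ∧ (b ∈ L ∨ b = v) ∧ (a₁ ∈ Rt ∨ a₁ = v) ∧ (a₂ ∈ Rt ∨ a₂ = v) ∧ (a₃ ∈ Rt ∨ a₃ = v))

/-- **The cut-vertex-reduced class**: `WReducedS`, and for every cut-vertex decomposition a
mark-free left side carries no non-loop edge, a single far mark has at most one non-loop edge on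
its side, and the marks are never split `2 + 3`. -/
structure WReducedC (ends : E → Sym2 V) (o a₁ a₂ a₃ b : V) : Prop
    extends WReducedS ends o a₁ a₂ a₃ b where
  /-- a mark-free side is loops only -/
  prune : ∀ (side : E → Bool) (L : Set V) (v : V) (Rt : Set V) (g : E),
    CutVertex ends side L v Rt → (∀ m ∈ ({o, a₁, a₂, a₃, b} : Set V), m ∈ Rt ∨ m = v) →
    side g = true → (ends g).IsDiag
  /-- a single far mark has at most one non-loop edge on its side -/
  oneFar : ∀ (side : E → Bool) (L : Set V) (v : V) (Rt : Set V) (w : V),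
    CutVertex ends side L v Rt → w ∈ L →
    (∀ m ∈ ({o, a₁, a₂, a₃, b} : Set V), m = w ∨ m ∈ Rt ∨ m = v) → leftCard ends side ≤ 1
  /-- no `2 + 3` split of the marks at a cut vertex -/
  twoThree : ∀ (side : E → Bool) (L : Set V) (v : V) (Rt : Set V),
    CutVertex ends side L v Rt → ¬ TwoThree L v Rt o a₁ a₂ a₃ b

end ClassC

section Closure

variable (R : Type*) [Field R] [LinearOrder R] [IsStrictOrderedRing R]

/-- **(HCOV) on the cut-vertex-reduced class**. -/
def HCovWRedC_all : Prop :=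
  ∀ (V E : Type) [Fintype V] [DecidableEq V] [Fintype E] [DecidableEq E]
    (ends : E → Sym2 V) (p : E → R), IsProbVec p →
    ∀ o a₁ a₂ a₃ b : V, a₁ ≠ a₂ → a₁ ≠ a₃ → a₂ ≠ a₃ → o ≠ a₁ → o ≠ a₂ → o ≠ a₃ → o ≠ b →
      b ≠ a₁ → b ≠ a₂ → b ≠ a₃ → WReducedC ends o a₁ a₂ a₃ b → HCov p ends o a₁ a₂ a₃ b

end Closure

/-! ## The reduction across edge types -/

section Main

variable {R : Type*} [Field R] [LinearOrder R] [IsStrictOrderedRing R]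

/-- **The reduction to the cut-vertex-reduced class**, by strong induction on the number of
non-loop edges over all finite edge types: the moves of `GcSkelReduction` / `GcSkelReductionS`,
then a mark-free side is pruned, a single far side is replaced by its pendant edge, a `2 + 3` split
is a theorem; else the instance is in `WReducedC`. -/
theorem HCov_of_wredC_of_base (hB : HCovWRedC_all R) (n : ℕ) :
    ∀ (V E : Type) [Fintype V] [DecidableEq V] [Fintype E] [DecidableEq E] (ends : E → Sym2 V),
      nonLoopCard ends = n → ∀ (p : E → R), IsProbVec p →
      ∀ o a₁ a₂ a₃ b : V, a₁ ≠ a₂ → a₁ ≠ a₃ → a₂ ≠ a₃ → o ≠ a₁ → o ≠ a₂ → o ≠ a₃ → o ≠ b →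
        b ≠ a₁ → b ≠ a₂ → b ≠ a₃ → HCov p ends o a₁ a₂ a₃ b := by
  induction n using Nat.strong_induction_on with
  | _ n ih =>
  intro V E _ _ _ _ ends hn p hp o a₁ a₂ a₃ b h12 h13 h23 ho1 ho2 ho3 hob hb1 hb2 hb3
  have ih' : IHBelow R V E n := fun ends' hlt => ih _ hlt V E ends' rfl
  by_cases hsimp : Simple ends
  swap
  · -- a parallel pair: merge it
    unfold Simple at hsimp
    push Not at hsimp
    obtain ⟨g₁, g₂, hg12, hnd, hpar⟩ := hsimp
    obtain ⟨u, v, huv⟩ : ∃ u v, ends g₁ = s(u, v) :=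
      (Sym2.exists (f := fun t => ends g₁ = t)).1 ⟨ends g₁, rfl⟩
    have hnd2 : ¬ (ends g₂).IsDiag := by rw [← hpar]; exact hnd
    unfold HCov
    rw [Gc_parallel p hg12 hpar.symm u o a₁ a₂ a₃ b]
    exact ih' _ (hn ▸ nonLoopCard_update_loop_lt ends hnd2 u) _ (isProbVec_parallel hp g₁ g₂)
      o a₁ a₂ a₃ b h12 h13 h23 ho1 ho2 ho3 hob hb1 hb2 hb3
  by_cases hun : ∃ y, Unmarked o a₁ a₂ a₃ b y ∧ (nonLoopDeg ends y = 1 ∨ nonLoopDeg ends y = 2)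
  · obtain ⟨y, hy, hd⟩ := hun
    rcases hd with h1 | h2
    · -- an unmarked leaf: delete it
      obtain ⟨e, x, he, hxy, hleaf⟩ := leaf_of_nonLoopDeg_one h1
      have hne : ¬ (ends e).IsDiag := by
        rw [he, Sym2.mk_isDiag_iff]
        exact hxy
      unfold HCov
      rw [Gc_leaf_at p he hxy hy hleaf]
      exact ih' _ (hn ▸ nonLoopCard_update_loop_lt ends hne x) p hp o a₁ a₂ a₃ b h12 h13 h23
        ho1 ho2 ho3 hob hb1 hb2 hb3
    · -- an unmarked series vertex: contract it
      obtain ⟨e, f, x, w, hef, he, hf, hxy, hyw, hdeg⟩ := series_of_nonLoopDeg_two h2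
      unfold HCov
      rw [Gc_series_at p he hf hef hxy hyw hy hdeg]
      exact ih' _ (hn ▸ nonLoopCard_contract_lt ends hxy he) _ (isProbVec_series hp e f)
        o a₁ a₂ a₃ b h12 h13 h23 ho1 ho2 ho3 hob hb1 hb2 hb3
  by_cases hdo : nonLoopDeg ends o = 1
  · exact HCov_of_o_leaf ih' ends hn p hp o a₁ a₂ a₃ b h12 h13 h23 ho1 ho2 ho3 hob hb1 hb2 hb3
      hdo
  by_cases hdb : nonLoopDeg ends b = 1
  · exact HCov_of_b_leaf ih' ends hn p hp o a₁ a₂ a₃ b h12 h13 h23 ho1 ho2 ho3 hob hb1 hb2 hb3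
      hdb
  by_cases h3 : ∃ (e : E) (x : V), ends e = s(x, a₃) ∧ x ≠ a₃ ∧ nonLoopDeg ends a₃ = 1 ∧
      ¬ Unmarked o a₁ a₂ a₃ b x
  · obtain ⟨e, x, he, hx, hd, hm⟩ := h3
    exact HCov_of_a3_leaf_marked ends p hp o a₁ a₂ a₃ b h13 h23 ho3 hb3 hd ⟨e, x, he, hx, hm⟩
  by_cases h1 : ∃ (e : E) (x : V), ends e = s(x, a₁) ∧ x ≠ a₁ ∧ nonLoopDeg ends a₁ = 1 ∧
      ¬ Unmarked o a₁ a₂ a₃ b x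
  · obtain ⟨e, x, he, hx, hd, hm⟩ := h1
    exact HCov_of_a1_leaf_marked ends p hp o a₁ a₂ a₃ b h12 h13 ho1 hb1 hd ⟨e, x, he, hx, hm⟩
  by_cases h2 : ∃ (e : E) (x : V), ends e = s(x, a₂) ∧ x ≠ a₂ ∧ nonLoopDeg ends a₂ = 1 ∧
      ¬ Unmarked o a₁ a₂ a₃ b x
  · obtain ⟨e, x, he, hx, hd, hm⟩ := h2
    exact HCov_of_a2_leaf_marked ends p hp o a₁ a₂ a₃ b h12 h23 ho2 hb2 hd ⟨e, x, he, hx, hm⟩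
  -- a mark-free side with a non-loop edge: prune it
  by_cases hP : ∃ (side : E → Bool) (L : Set V) (v : V) (Rt : Set V) (g : E),
      CutVertex ends side L v Rt ∧ (∀ m ∈ ({o, a₁, a₂, a₃, b} : Set V), m ∈ Rt ∨ m = v) ∧
      side g = true ∧ ¬ (ends g).IsDiag
  · obtain ⟨side, L, v, Rt, g, h, hM, hg, hgd⟩ := hP
    exact CutPrune.HCov_of_right h p o a₁ a₂ a₃ b hM
      (ih _ (hn ▸ nonLoopCard_prune_lt hg hgd) V _ (CutPrune.rends ends side) rfl _
        (CutPrune.isProbVec_rweights hp) o a₁ a₂ a₃ b h12 h13 h23 ho1 ho2 ho3 hob hb1 hb2 hb3)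
  -- a single far mark with at least two non-loop edges on its side: the pendant reduction
  by_cases hO : ∃ (side : E → Bool) (L : Set V) (v : V) (Rt : Set V) (w : V),
      CutVertex ends side L v Rt ∧ w ∈ L ∧
      (∀ m ∈ ({o, a₁, a₂, a₃, b} : Set V), m = w ∨ m ∈ Rt ∨ m = v) ∧ 1 < leftCard ends side
  · obtain ⟨side, L, v, Rt, w, h, hw, hM, hlt⟩ := hO
    obtain ⟨g₁, hg₁, g₂, hg₂, hne⟩ := Finset.one_lt_card.1 hlt
    rw [Finset.mem_filter] at hg₁ hg₂
    exact CutOneFar.HCov_of_reduced h hw p o a₁ a₂ a₃ b hM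
      (ih _ (hn ▸ nonLoopCard_oneFar_lt v w hne hg₁.2.1 hg₁.2.2 hg₂.2.1 hg₂.2.2) V _
        (CutOneFar.rends ends side v w) rfl _
        (CutOneFar.isProbVec_rweights_leftProb ends side v w hp) o a₁ a₂ a₃ b h12 h13 h23 ho1
        ho2 ho3 hob hb1 hb2 hb3)
  -- a `2 + 3` split: the two-far-mark theorem
  by_cases hT : ∃ (side : E → Bool) (L : Set V) (v : V) (Rt : Set V),
      CutVertex ends side L v Rt ∧ TwoThree L v Rt o a₁ a₂ a₃ b
  · obtain ⟨side, L, v, Rt, h, htt⟩ := hT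
    exact CutTwoFar.HCov_cut_twoLeft h hp htt
  -- the cut-vertex-reduced class
  push Not at hun h3 h1 h2 hP hO hT
  exact hB V E ends p hp o a₁ a₂ a₃ b h12 h13 h23 ho1 ho2 ho3 hob hb1 hb2 hb3
    ⟨⟨⟨hsimp, hun, hdo, hdb⟩, h3, h1, h2⟩, hP, hO, hT⟩

/-- **THE CUT-VERTEX-REDUCED-CLASS THEOREM**: (HCOV) for every finite weighted graph with five
distinct marks follows from (HCOV) on the cores — simple graphs whose unmarked vertices have
non-loop degree `0` or `≥ 3`, whose `o`, `b` are not leaves, whose pendant marks hang at unmarked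
vertices, with no mark-free side, no single far mark with two edges behind it, and no `2 + 3` split
at any cut vertex. -/
theorem HCov_all_of_HCovWRedC_all (hB : HCovWRedC_all R) : HCov_all R := by
  intro V E _ _ _ _ ends p hp o a₁ a₂ a₃ b h12 h13 h23 ho1 ho2 ho3 hob hb1 hb2 hb3
  exact HCov_of_wredC_of_base hB _ V E ends rfl p hp o a₁ a₂ a₃ b h12 h13 h23 ho1 ho2 ho3 hob hb1
    hb2 hb3

/-- The cores are a faithful reduction: `HCov_all ↔ HCovWRedC_all`. -/
theorem HCov_all_iff_HCovWRedC_all : HCov_all R ↔ HCovWRedC_all R :=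
  ⟨fun h V E _ _ _ _ ends p hp o a₁ a₂ a₃ b h12 h13 h23 ho1 ho2 ho3 hob hb1 hb2 hb3 _ =>
    h V E ends p hp o a₁ a₂ a₃ b h12 h13 h23 ho1 ho2 ho3 hob hb1 hb2 hb3,
   HCov_all_of_HCovWRedC_all⟩

end Main

end WRed

end Summit.Ventures.PercRepro2
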